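import Summits.BirchSwinnertonDyer.BirchSwinnertonDyer.Theorems.CountingDoorF2AtThreeSchneiderOnDoorSubfamilyCrossTerm
import HarnessLib

/-!
# BirchSwinnertonDyer / CountingDoorF2AtThree — crux I4loc `SchneiderOnDoorSubfamily`
# (stmt-BirchSwinnertonDyer-19682), line `valuation-class-at-three` (v3): the division values of
# `2P₁`, `3P₂` on the CERTIFICATE CLASS `a ≡ (7, 0, 4, 0) (mod 9)`, `a ≡ (1, 2, 4, 3) (mod 7)`

Helper file (`--supports stmt-BirchSwinnertonDyer-19682 --as helper`; cell bsd-rank2, seat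
cd-valclass-denom; PARTITION: none — r_an ≥ 2, summit axis S0). The v3 skeleton's load-bearing
`stub_heightDigits` (seat cd-valclass-digits) certifies the first `3`-adic digits of `⟨2P₁, 2P₁⟩/3` and
`⟨3P₂, 3P₂⟩/3` on the class `c = (7, 0, 4, 0) mod 9` of `(a₁, a₂, a₂', a₃)` inside the door class (and
`(1, 0, 1, 0) mod 25`, `(1, 2, 4, 3) mod 7`). With the S2 package (`…Denominator`: `⟨nPᵢ, nPᵢ⟩ = log₃ ψₙ² −
2 log₃ σ₃(−φₙψₙ/ωₙ)`, first order `‖⟨nPᵢ,nPᵢ⟩ − log₃ φₙ(Pᵢ)‖ ≤ ‖ψₙ(Pᵢ)‖₃`) and the explicit values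
(`…DivisionValues`), the class-level INPUTS of that certificate are polynomial congruences, decided here in
`ZMod 9` / `ZMod 7` for EVERY member of the class:

* `ψ₂(P₁) ≡ 0 (mod 9)` (so `‖ψ₂(P₁)‖₃ ≤ 3⁻²` and the FIRST-ORDER bound already gives
  `‖⟨2P₁, 2P₁⟩ − log₃ φ₂(P₁)‖ ≤ 3⁻²` — no sigma expansion needed for the `2P₁` digit);
  `ψ₂(P₁) ≡ 5 (mod 7)`, in particular `ψ₂(P₁) ≠ 0` (`2P₁ ≠ O`);
* `φ₂(P₁) ≡ 4 (mod 9)`;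
* `ψ₃(P₂) ≡ 6 (mod 9)`: `3 ∣ ψ₃(P₂)`, `9 ∤ ψ₃(P₂)`, `ψ₃(P₂) ≠ 0`, `‖ψ₃(P₂)‖₃ = 3⁻¹` (level exactly `1`: the
  `3P₂` digit needs the second-order bound `‖ĥ₃ − log₃ num x‖ ≤ ‖x‖⁻¹`, seat cd-valclass-sigma3);
* `φ₃(P₂) = a₂'Ψ₃(a₂')² − preΨ₄(a₂')ψ₂(P₂)²` and `φ₃(P₂) ≡ 7 (mod 9)`.

(eng-2 T12.md §4–§5 found these residues numerically: `(φ₂(P₁), φ₃(P₂)) ≡ (4, 7)`, `ψ₃ ≡ 24 (mod 27)` at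
`a* = (−524, 450, −374, 3825)`; here they are theorems for the whole class.) B1 honesty: polynomial
congruences only; nothing here mentions a Selmer group, an `L`-value or an analytic rank.

References: Silverman *AEC* Ex. 3.7 [SilvermanAEC2009]; Mazur–Stein–Tate 2006 §1 [MazurSteinTate2006].
-/

-- the summit namespace `Summit.BirchSwinnertonDyer.BirchSwinnertonDyer.Theorems` repeats a component by design
-- (single-conjunct summit, CONVENTIONS §1), which the `dupNamespace` linter would flag on every declaration.
set_option linter.dupNamespace false

noncomputable section

open scoped Classical
open Polynomial WeierstrassCurve Literature.NumberTheory.EllipticCurves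
  Literature.NumberTheory.EllipticCurves.BhargavaHo2022

namespace Summit.BirchSwinnertonDyer.BirchSwinnertonDyer.Theorems

variable (a : Params)

/-! ### `φ₃(P₂)` explicitly -/

/-- **`φ₃(P₂) = a₂'Ψ₃(a₂')² − preΨ₄(a₂')(a₁a₂' + a₃)²`** (`φ₃ = xΨ₃² − preΨ₄ψ₂²`). [cite: SilvermanAEC2009, Exercise 3.7(d)] -/
theorem params_φ_three_markedPoint₂ :
    (a.curveInt.φ 3).evalEval a.a₂' 0 =
      a.a₂' * (a.curveInt.Ψ₃.eval a.a₂') ^ 2 - a.curveInt.preΨ₄.eval a.a₂' * (a.a₁ * a.a₂' + a.a₃) ^ 2 := by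
  rw [WeierstrassCurve.φ_three, evalEval_sub, evalEval_mul, evalEval_mul, evalEval_C, evalEval_pow,
    evalEval_C, eval_X, evalEval_C, evalEval_pow, ← WeierstrassCurve.ψ_two, params_ψ_two_markedPoint₂]

/-- `ψ₃(P₂)` as an explicit polynomial in the parameters (through the `b`-invariants). [cite: SilvermanAEC2009, Exercise 3.7(d)] -/
theorem params_ψ_three_markedPoint₂_eq : (a.curveInt.ψ 3).evalEval a.a₂' 0 =
    3 * a.a₂' ^ 4 + a.a₁ ^ 2 * a.a₂' ^ 3 +
      3 * (a.a₁ * a.a₃ - 2 * (a.a₂ ^ 2 + a.a₂ * a.a₂' + a.a₂' ^ 2)) * a.a₂' ^ 2 +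
        3 * (a.a₃ ^ 2 + 4 * (a.a₂ * a.a₂' * (a.a₂ + a.a₂'))) * a.a₂' +
          (a.a₁ ^ 2 * (a.a₂ * a.a₂' * (a.a₂ + a.a₂')) + a.a₁ * a.a₃ * (a.a₂ ^ 2 + a.a₂ * a.a₂' + a.a₂' ^ 2) -
            (a.a₂ ^ 2 + a.a₂ * a.a₂' + a.a₂' ^ 2) ^ 2) := by
  rw [params_ψ_three_eval, params_Ψ₃_eval, params_curveInt_b₂, params_curveInt_b₄, params_curveInt_b₆,
    params_curveInt_b₈]

/-! ### The certificate class `(7, 0, 4, 0) mod 9` -/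

section Mod9

variable {a}

/-- **`ψ₂(P₁) ≡ 0 (mod 9)`** on the class (`a₂ ≡ a₃ ≡ 0 (mod 9)`). [cite: SilvermanAEC2009, Exercise 3.7(d)] -/
theorem params_nine_dvd_ψ_two_markedPoint₁ (h₂ : (a.a₂ : ZMod 9) = 0) (h₃ : (a.a₃ : ZMod 9) = 0) :
    (9 : ℤ) ∣ (a.curveInt.ψ 2).evalEval a.a₂ 0 := by
  rw [params_ψ_two_markedPoint₁]
  show ((9 : ℕ) : ℤ) ∣ _
  rw [← ZMod.intCast_zmod_eq_zero_iff_dvd]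
  push_cast
  rw [h₂, h₃]
  simp

/-- **`φ₂(P₁) ≡ 4 (mod 9)`** on the class. [cite: SilvermanAEC2009, Exercise 3.7(d)] -/
theorem params_φ_two_markedPoint₁_zmod_nine (h₁ : (a.a₁ : ZMod 9) = 7) (h₂ : (a.a₂ : ZMod 9) = 0)
    (h₂' : (a.a₂' : ZMod 9) = 4) (h₃ : (a.a₃ : ZMod 9) = 0) :
    (((a.curveInt.φ 2).evalEval a.a₂ 0 : ℤ) : ZMod 9) = 4 := by
  rw [params_φ_two_markedPoint₁, params_Ψ₃_eval, params_curveInt_b₂, params_curveInt_b₄,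
    params_curveInt_b₆, params_curveInt_b₈]
  push_cast
  rw [h₁, h₂, h₂', h₃]
  decide

/-- **`ψ₃(P₂) ≡ 6 (mod 9)`** on the class (the level of `3P₂` is exactly `1`). [cite: SilvermanAEC2009, Exercise 3.7(d)] -/
theorem params_ψ_three_markedPoint₂_zmod_nine (h₁ : (a.a₁ : ZMod 9) = 7) (h₂ : (a.a₂ : ZMod 9) = 0)
    (h₂' : (a.a₂' : ZMod 9) = 4) (h₃ : (a.a₃ : ZMod 9) = 0) :
    (((a.curveInt.ψ 3).evalEval a.a₂' 0 : ℤ) : ZMod 9) = 6 := by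
  rw [params_ψ_three_markedPoint₂_eq]
  push_cast
  rw [h₁, h₂, h₂', h₃]
  decide

/-- **`φ₃(P₂) ≡ 7 (mod 9)`** on the class. [cite: SilvermanAEC2009, Exercise 3.7(d)] -/
theorem params_φ_three_markedPoint₂_zmod_nine (h₁ : (a.a₁ : ZMod 9) = 7) (h₂ : (a.a₂ : ZMod 9) = 0)
    (h₂' : (a.a₂' : ZMod 9) = 4) (h₃ : (a.a₃ : ZMod 9) = 0) :
    (((a.curveInt.φ 3).evalEval a.a₂' 0 : ℤ) : ZMod 9) = 7 := by
  rw [params_φ_three_markedPoint₂, params_Ψ₃_eval, params_preΨ₄_eval, params_curveInt_b₂,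
    params_curveInt_b₄, params_curveInt_b₆, params_curveInt_b₈]
  push_cast
  rw [h₁, h₂, h₂', h₃]
  decide

/-- `3 ∣ ψ₃(P₂)`, `9 ∤ ψ₃(P₂)` on the class; in particular `ψ₃(P₂) ≠ 0` (`3P₂ ≠ O`). [cite: SilvermanAEC2009, Exercise 3.7(d)] -/
theorem params_three_dvd_not_nine_dvd_ψ_three_markedPoint₂ (h₁ : (a.a₁ : ZMod 9) = 7)
    (h₂ : (a.a₂ : ZMod 9) = 0) (h₂' : (a.a₂' : ZMod 9) = 4) (h₃ : (a.a₃ : ZMod 9) = 0) :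
    (3 : ℤ) ∣ (a.curveInt.ψ 3).evalEval a.a₂' 0 ∧ ¬ (9 : ℤ) ∣ (a.curveInt.ψ 3).evalEval a.a₂' 0 ∧
      (a.curveInt.ψ 3).evalEval a.a₂' 0 ≠ 0 := by
  have h9 := params_ψ_three_markedPoint₂_zmod_nine h₁ h₂ h₂' h₃
  have hnot : ¬ (9 : ℤ) ∣ (a.curveInt.ψ 3).evalEval a.a₂' 0 := by
    intro hd
    have h0 : (((a.curveInt.ψ 3).evalEval a.a₂' 0 : ℤ) : ZMod 9) = 0 :=
      (ZMod.intCast_zmod_eq_zero_iff_dvd _ 9).mpr (by exact_mod_cast hd)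
    rw [h0] at h9
    exact absurd h9 (by decide)
  refine ⟨?_, hnot, fun h0 => hnot (by rw [h0]; exact dvd_zero _)⟩
  have h3 : (((a.curveInt.ψ 3).evalEval a.a₂' 0 : ℤ) : ZMod 3) = 0 := by
    have := congrArg (ZMod.castHom (show 3 ∣ 9 by norm_num) (ZMod 3)) h9
    rw [map_intCast] at this
    rw [this]
    decide
  exact_mod_cast (ZMod.intCast_zmod_eq_zero_iff_dvd _ 3).mp h3

/-- **`‖ψ₂(P₁)‖₃ ≤ 3⁻²`** on the class. [cite: SilvermanAEC2009, Exercise 3.7(d)] -/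
theorem params_norm_ψ_two_markedPoint₁_le (h₂ : (a.a₂ : ZMod 9) = 0) (h₃ : (a.a₃ : ZMod 9) = 0) :
    ‖(((a.curveInt.ψ 2).evalEval a.a₂ 0 : ℤ) : ℚ_[3])‖ ≤ (3 : ℝ)⁻¹ ^ 2 := by
  have h9 := params_nine_dvd_ψ_two_markedPoint₁ h₂ h₃
  have h9' : ((3 ^ 2 : ℕ) : ℤ) ∣ (a.curveInt.ψ 2).evalEval a.a₂ 0 := by
    rw [show ((3 ^ 2 : ℕ) : ℤ) = 9 by norm_num]; exact h9
  have key := (Padic.norm_int_le_pow_iff_dvd (p := 3) ((a.curveInt.ψ 2).evalEval a.a₂ 0) 2).mpr h9'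
  have e : ((3 : ℕ) : ℝ) ^ (-((2 : ℕ) : ℤ)) = (3 : ℝ)⁻¹ ^ 2 := by norm_num
  rwa [e] at key

/-- **`‖ψ₃(P₂)‖₃ = 3⁻¹`** on the class. [cite: SilvermanAEC2009, Exercise 3.7(d)] -/
theorem params_norm_ψ_three_markedPoint₂_eq (h₁ : (a.a₁ : ZMod 9) = 7) (h₂ : (a.a₂ : ZMod 9) = 0)
    (h₂' : (a.a₂' : ZMod 9) = 4) (h₃ : (a.a₃ : ZMod 9) = 0) :
    ‖(((a.curveInt.ψ 3).evalEval a.a₂' 0 : ℤ) : ℚ_[3])‖ = (3 : ℝ)⁻¹ := by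
  obtain ⟨h3, hn9, -⟩ := params_three_dvd_not_nine_dvd_ψ_three_markedPoint₂ h₁ h₂ h₂' h₃
  have hle : ‖(((a.curveInt.ψ 3).evalEval a.a₂' 0 : ℤ) : ℚ_[3])‖ ≤ ((3 : ℕ) : ℝ)⁻¹ :=
    norm_le_inv_of_norm_lt_one (Padic.norm_intCast_lt_one_iff.mpr (by exact_mod_cast h3))
  have hn9' : ¬ ((3 ^ 2 : ℕ) : ℤ) ∣ (a.curveInt.ψ 3).evalEval a.a₂' 0 := by
    rw [show ((3 ^ 2 : ℕ) : ℤ) = 9 by norm_num]; exact hn9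
  have hnot := (Padic.norm_int_le_pow_iff_dvd (p := 3) ((a.curveInt.ψ 3).evalEval a.a₂' 0) 2).not.mpr hn9'
  have hge : ((3 : ℕ) : ℝ)⁻¹ ≤ ‖(((a.curveInt.ψ 3).evalEval a.a₂' 0 : ℤ) : ℚ_[3])‖ := by
    by_contra hlt
    rw [not_le] at hlt
    apply hnot
    refine (Padic.norm_le_pow_iff_norm_lt_pow_add_one _ _).mpr ?_
    have e : ((3 : ℕ) : ℝ) ^ (-((2 : ℕ) : ℤ) + 1) = ((3 : ℕ) : ℝ)⁻¹ := by norm_num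
    rw [e]
    exact hlt
  have e3 : ((3 : ℕ) : ℝ)⁻¹ = (3 : ℝ)⁻¹ := by norm_num
  rw [← e3]
  exact le_antisymm hle hge

/-- **The `2P₁` term to second `3`-adic order from the FIRST-order bound**: on the class, for a type-∅ member,
`ψ₂(P₁) ≠ 0` and a canonical `Dh`: `‖⟨2P₁, 2P₁⟩ − log₃ φ₂(P₁)‖₃ ≤ 3⁻²` (as `‖ψ₂(P₁)‖₃ ≤ 3⁻²`), with
`φ₂(P₁) ≡ 4 (mod 9)`; so the first digit of `⟨2P₁,2P₁⟩/3` is that of `log₃(φ₂(P₁))/3`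
(`log₃ u ≡ (u² − 1)/2 (mod 9)` gives the digit `1`). [cite: MazurSteinTate2006, §1 eq. (1.1) and Alg. 3.4 (steps 1–4)] -/
theorem params_norm_pairing_two_markedPoint₁_sub_log_le (hΔ : ∀ ℓ : ℕ, ℓ.Prime → ¬ (ℓ : ℤ) ^ 2 ∣ a.curveInt.Δ)
    (h : a.IsMember) (h₂ : (a.a₂ : ZMod 9) = 0) (h₃ : (a.a₃ : ZMod 9) = 0)
    (h0 : (a.curveInt.ψ 2).evalEval a.a₂ 0 ≠ 0) {Dh : PAdicHeightData a.curve 3} (hDh : Dh.IsCanonical) :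
    ‖Dh.pairing (2 • a.markedPoint₁ h) (2 • a.markedPoint₁ h) -
        padicLog 3 (((a.curveInt.φ 2).evalEval a.a₂ 0 : ℤ) : ℚ_[3])‖ ≤ (3 : ℝ)⁻¹ ^ 2 := by
  have h9 := params_nine_dvd_ψ_two_markedPoint₁ h₂ h₃
  have h3 : (3 : ℤ) ∣ (a.curveInt.ψ ((2 : ℕ) : ℤ)).evalEval a.a₂ 0 :=
    (show (3 : ℤ) ∣ 9 by norm_num).trans (by exact_mod_cast h9)
  have h0' : (a.curveInt.ψ ((2 : ℕ) : ℤ)).evalEval a.a₂ 0 ≠ 0 := by exact_mod_cast h0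
  have key := (params_pairing_nsmul_markedPoint₁_at_three hDh hΔ h h0' h3).2.2.2
  have hψ := params_norm_ψ_two_markedPoint₁_le h₂ h₃
  have e : (a.curveInt.ψ ((2 : ℕ) : ℤ)) = a.curveInt.ψ 2 := by norm_num
  have e' : (a.curveInt.φ ((2 : ℕ) : ℤ)) = a.curveInt.φ 2 := by norm_num
  rw [e, e'] at key
  exact key.trans hψ

end Mod9

/-! ### The class `(1, 2, 4, 3) mod 7`: `2P₁ ≠ O` -/

/-- **`ψ₂(P₁) ≡ 5 (mod 7)`** on the class `a ≡ (1, 2, 4, 3) (mod 7)` of the door family; in particular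
`ψ₂(P₁) ≠ 0`, i.e. `2P₁ ≠ O`. [cite: SilvermanAEC2009, Exercise 3.7(d)] -/
theorem params_ψ_two_markedPoint₁_zmod_seven (h₁ : (a.a₁ : ZMod 7) = 1) (h₂ : (a.a₂ : ZMod 7) = 2)
    (h₃ : (a.a₃ : ZMod 7) = 3) :
    (((a.curveInt.ψ 2).evalEval a.a₂ 0 : ℤ) : ZMod 7) = 5 ∧ (a.curveInt.ψ 2).evalEval a.a₂ 0 ≠ 0 := by
  have h5 : (((a.curveInt.ψ 2).evalEval a.a₂ 0 : ℤ) : ZMod 7) = 5 := by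
    rw [params_ψ_two_markedPoint₁]; push_cast; rw [h₁, h₂, h₃]; decide
  refine ⟨h5, fun h0 => ?_⟩
  rw [h0, Int.cast_zero] at h5
  exact absurd h5 (by decide)

end Summit.BirchSwinnertonDyer.BirchSwinnertonDyer.Theorems

end
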